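import Literature.Analysis.ValidatedNumerics.RumpLinearSystemVerification
import HarnessLib

/-!
# Rump's inner inclusion of the solution set of an interval linear system (Acta Numerica 2010, Thm 10.9)

Topic `Literature/Analysis/ValidatedNumerics`, namespace
`Literature.Analysis.ValidatedNumerics.RumpLinearSystem` (sibling of
`RumpLinearSystemVerification.lean`, which holds Theorems 10.6 / (10.14) / 10.8 and is at the file-size
cap).  Cell certnum (CERTIFIED-NUMERICS STACK, D-0105 (6)), layer L4: the soundness statement behind an
optional «inner» field of a verified linear solve (`ila.solve_enclosure` / INTLAB `verifylss`): how much
of the width of the outer inclusion is SENSITIVITY of the problem rather than overestimation.  HONEST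
FRAMING: a typed and PROVED implication; it certifies no engine output.  WHAT THIS IS NOT: not a
floating-point theorem (the directed-rounding evaluation of `Z̲`, `Z̄`, `Δ` is the engine's business —
Rump: "Special care is necessary when applying this on the computer because lower and upper bounds are
required in (10.23) for `Z̲` and for `Z̄`"); not the tolerable / controllable solution sets (10.18)–(10.19).

SOURCE (read on the page): S. M. Rump, *Verification methods: rigorous results using floating-point
arithmetic*, Acta Numerica 19 (2010) 287–449 [Rump2010Verification], §10.6 «Inner inclusion»; held copy
`paper:url-cae7890f58e7`, chunks p0085 L17–p0086 L30 (printed pp. 61–62).  Verbatim (overlines and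
underlines restored from the proof text):

> The best-possible computable inclusion `Y ∈ 𝕀𝔽` is `Y := ⋂ {Z ∈ 𝕀𝔽 : Σ(𝐀, 𝐛) ⊆ Z} = hull(Σ(𝐀, 𝐛))`.
> (10.20) […] **Theorem 10.9.** Let `𝐀 ∈ 𝕀ℝⁿˣⁿ`, `𝐛 ∈ 𝕀ℝⁿ`, `x̃ ∈ ℝⁿ` and `X ∈ 𝕀ℝⁿ` be given. Define
> `Z := R(𝐛 − 𝐀x̃)` and `Δ := (I − R𝐀)X`, (10.21) and suppose `Z + Δ ⊂ int(X)`. (10.22)  Then `R` and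
> every matrix `A ∈ 𝐀` is non-singular, and `Y` as defined in (10.20) satisfies
> `x̃ + Z̲ + Δ̲ ≤ Y̲ ≤ x̃ + Z̲ + Δ̄` and `x̃ + Z̄ + Δ̲ ≤ Ȳ ≤ x̃ + Z̄ + Δ̄`. (10.23)
> *Proof.* Let `A ∈ 𝐀` and `b ∈ 𝐛` be given. Applying Theorem 10.6 to the linear system `Ay = b − Ax̃`
> implies that `A` and `R` are non-singular, and `y = A⁻¹b − x̃ ∈ Z + Δ`. Since `A` and `b` are chosen
> arbitrarily and `Z + Δ = [Z̲ + Δ̲, Z̄ + Δ̄]`, this proves `Σ(𝐀, 𝐛) ⊆ x̃ + Z + Δ` and the first and last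
> inequality in (10.23). […] Furthermore, `{x̃ + R(b − Ax̃) : A ∈ 𝐀, b ∈ 𝐛} = {A⁻¹b − (I − RA)(A⁻¹b − x̃)
> : A ∈ 𝐀, b ∈ 𝐛} ⊆ … ⊆ Σ(𝐀, 𝐛) − Δ`, where all set operations, even on interval quantities, are power
> set operations. […] (9.4) and (9.6) imply `x̃ + [Z̲, Z̄] = x̃ + Z ⊆ Y − Δ = [Y̲ − Δ̄, Ȳ − Δ̲]`. (10.24)
> […] For interval input `𝐀, 𝐛`, Theorem 10.9 yields an inner inclusion `x̃ + [Z̲ + Δ̄, Z̄ + Δ̲]`,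
> provided the radius of `Δ` is no larger than the radius of `Z`.

## Rendering and faithfulness
* As in the sibling file, the test (10.22) is rendered by the exact range: `R(b − Ax̃) + (I − RA)x ∈
  int(X)` for all members `A`, `b` and all `x ∈ X = [l, u]` (`l ≤ u`); `Δ = [Δ̲, Δ̄]` is ANY box with
  `(I − RA)x ∈ Δ` for all members `A` and `x ∈ X` (what the machine's outward evaluation gives — Rump:
  "for the outer and the inner bounds of `Y` only an outer inclusion of `Δ` is necessary").
* `Y = hull(Σ)`: `Y̲ᵢ = inf {xᵢ : x ∈ Σ}`, `Ȳᵢ = sup {xᵢ : x ∈ Σ}` (`sInf` / `sSup` of the image; §4), and,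
  free of conditional infima, the two inner inequalities are ALSO stated as «some point of `Σ` has
  `i`-th coordinate `≤ x̃ᵢ + Z̲ᵢ + Δ̄ᵢ`» / «`≥ x̃ᵢ + Z̄ᵢ + Δ̲ᵢ`» (§2–§3), which is how they are used.
* THE ONE POINT NEEDING CARE: the inner half of (10.23) uses that `Z̲ᵢ`, `Z̄ᵢ` are ATTAINED values of the
  range `{(R(b − Ax̃))ᵢ}` (power-set operations in the proof).  §2 states the theorem for ARBITRARY data
  sets `𝓐`, `𝓑` with attainment as a hypothesis; §3 DISCHARGES it for entrywise interval data
  `𝐀 = [A̲, Ā]`, `𝐛 = [b̲, b̄]`: `(R(b − Ax̃))ᵢ = Σⱼ Rᵢⱼ bⱼ − Σⱼₖ (Rᵢⱼ x̃ₖ) Aⱼₖ` is LINEAR in the entries,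
  each entry occurring once, so its minimum / maximum over the box is taken at the sign-selected corner
  (`loCornerMat/Vec`, `hiCornerMat/Vec`) — and that corner value (`zInf`, `zSup`) is exactly the
  infimum / supremum INTLAB's interval evaluation `R*(b − A*xs)` returns in exact arithmetic (no
  dependency, (9.4)/(9.6)).
* Matrices carry no order instance in Mathlib: the interval matrix is the explicit predicate `matBox`.

## Search record (TYPER LINT RULE)
`lean search 'inner.?inclusion|thm_10_9|hull.*solutionSet'` over `Literature/Analysis/ValidatedNumerics`:
no inner-inclusion statement; the sibling file's docstring lists Thm 10.9 as «not here»; certnum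
typed/INDEX.tsv row l.20 «Thm 10.9 inner inclusion still missing (deferred)» — closed by this file.

AI-produced formalisation (cell certnum, seat certnum-lean-1 gen 3, 2026-08-27).
-/

noncomputable section

open Set Matrix
open Literature.Analysis.ValidatedNumerics.IntervalLinearSystem (solutionSet)

namespace Literature.Analysis.ValidatedNumerics.RumpLinearSystem

variable {n : Type*} [Fintype n]

/-! ## §1 The member form: `A⁻¹b − x̃ − R(b − Ax̃) ∈ Δ` -/

/-- **Member form of (10.21)–(10.22).** Under the test `R(b − Ax̃) + (I − RA)x ∈ int(X)` for all
`x ∈ X = [l, u]` (nonempty), `A` is nonsingular and the solution decomposes as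
`A⁻¹b = x̃ + R(b − Ax̃) + (I − RA)x` for some `x ∈ X` — "`y = A⁻¹b − x̃ ∈ Z + Δ`" with the member's OWN
`Z`-value; hence `A⁻¹b − x̃ − R(b − Ax̃) ∈ [Δ̲, Δ̄]` for any enclosure `Δ` of `(I − RA)X`.
[cite: Rump2010Verification, Thm 10.9 (proof, first part)] -/
theorem inv_mulVec_sub_sub_mem [DecidableEq n] (A R : Matrix n n ℝ) (b xt : n → ℝ) {l u : n → ℝ}
    (hlu : l ≤ u) (h : ∀ x ∈ Icc l u, R *ᵥ (b - A *ᵥ xt) + (1 - R * A) *ᵥ x ∈ interior (Icc l u))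
    {Δlo Δhi : n → ℝ} (hΔ : ∀ x ∈ Icc l u, (1 - R * A) *ᵥ x ∈ Icc Δlo Δhi) :
    A.det ≠ 0 ∧ A⁻¹ *ᵥ b - xt - R *ᵥ (b - A *ᵥ xt) ∈ Icc Δlo Δhi := by
  obtain ⟨hA, -, x, hx, hsol⟩ := thm_10_6_residual A R b xt hlu h
  refine ⟨hA, ?_⟩
  have : A⁻¹ *ᵥ b - xt - R *ᵥ (b - A *ᵥ xt) = (1 - R * A) *ᵥ x := by rw [hsol]; abel
  rw [this]
  exact hΔ x hx

/-! ## §2 Theorem 10.9 for arbitrary data sets (attainment of `Z̲ᵢ`, `Z̄ᵢ` as hypotheses) -/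

section General

variable [DecidableEq n] {𝓐 : Set (Matrix n n ℝ)} {𝓑 : Set (n → ℝ)} {R : Matrix n n ℝ} {xt : n → ℝ}
  {l u Zlo Zhi Δlo Δhi : n → ℝ}

/-- **Theorem 10.9, OUTER half of (10.23):** `x̃ + Z̲ + Δ̲ ≤ x ≤ x̃ + Z̄ + Δ̄` for every `x ∈ Σ(𝓐, 𝓑)`
("`Σ(𝐀, 𝐛) ⊆ x̃ + Z + Δ` and the first and last inequality in (10.23)"), for any sets of members, any
range enclosure `[Z̲, Z̄] ∋ R(b − Ax̃)` and any enclosure `[Δ̲, Δ̄] ∋ (I − RA)x` (`x ∈ X`).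
[cite: Rump2010Verification, Thm 10.9 (10.23)] -/
theorem thm_10_9_outer (hlu : l ≤ u)
    (h : ∀ A ∈ 𝓐, ∀ b ∈ 𝓑, ∀ x ∈ Icc l u,
      R *ᵥ (b - A *ᵥ xt) + (1 - R * A) *ᵥ x ∈ interior (Icc l u))
    (hZ : ∀ A ∈ 𝓐, ∀ b ∈ 𝓑, R *ᵥ (b - A *ᵥ xt) ∈ Icc Zlo Zhi)
    (hΔ : ∀ A ∈ 𝓐, ∀ x ∈ Icc l u, (1 - R * A) *ᵥ x ∈ Icc Δlo Δhi) :
    solutionSet 𝓐 𝓑 ⊆ Icc (xt + Zlo + Δlo) (xt + Zhi + Δhi) := by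
  intro xh hxh
  obtain ⟨A, hA, b, hb, hAx⟩ := hxh
  obtain ⟨hdet, hmem⟩ := inv_mulVec_sub_sub_mem A R b xt hlu (h A hA b hb) (hΔ A hA)
  have hxh : xh = A⁻¹ *ᵥ b := by
    rw [← hAx, Matrix.mulVec_mulVec, Matrix.nonsing_inv_mul _ (isUnit_iff_ne_zero.2 hdet),
      Matrix.one_mulVec]
  have hz := hZ A hA b hb
  rw [← hxh] at hmem
  constructor
  · intro i
    have h1 := hmem.1 i; have h2 := hz.1 i
    simp only [Pi.sub_apply, Pi.add_apply] at h1 h2 ⊢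
    linarith
  · intro i
    have h1 := hmem.2 i; have h2 := hz.2 i
    simp only [Pi.sub_apply, Pi.add_apply] at h1 h2 ⊢
    linarith

/-- **Theorem 10.9, INNER half of (10.23), per member:** for every member `(A, b)` the point
`A⁻¹b ∈ Σ(𝓐, 𝓑)` satisfies `x̃ + R(b − Ax̃) + Δ̲ ≤ A⁻¹b ≤ x̃ + R(b − Ax̃) + Δ̄` — the set inclusion
"`{x̃ + R(b − Ax̃) : A ∈ 𝐀, b ∈ 𝐛} ⊆ Σ(𝐀, 𝐛) − Δ`" of the printed proof.
[cite: Rump2010Verification, Thm 10.9 (proof, (10.24))] -/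
theorem thm_10_9_member (hlu : l ≤ u)
    (h : ∀ A ∈ 𝓐, ∀ b ∈ 𝓑, ∀ x ∈ Icc l u,
      R *ᵥ (b - A *ᵥ xt) + (1 - R * A) *ᵥ x ∈ interior (Icc l u))
    (hΔ : ∀ A ∈ 𝓐, ∀ x ∈ Icc l u, (1 - R * A) *ᵥ x ∈ Icc Δlo Δhi) {A : Matrix n n ℝ} (hA : A ∈ 𝓐)
    {b : n → ℝ} (hb : b ∈ 𝓑) :
    A⁻¹ *ᵥ b ∈ solutionSet 𝓐 𝓑 ∧
      A⁻¹ *ᵥ b ∈ Icc (xt + R *ᵥ (b - A *ᵥ xt) + Δlo) (xt + R *ᵥ (b - A *ᵥ xt) + Δhi) := by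
  obtain ⟨hdet, hmem⟩ := inv_mulVec_sub_sub_mem A R b xt hlu (h A hA b hb) (hΔ A hA)
  refine ⟨⟨A, hA, b, hb, ?_⟩, ?_, ?_⟩
  · rw [Matrix.mulVec_mulVec, Matrix.mul_nonsing_inv _ (isUnit_iff_ne_zero.2 hdet), Matrix.one_mulVec]
  · intro i
    have h1 := hmem.1 i
    simp only [Pi.sub_apply, Pi.add_apply] at h1 ⊢
    linarith
  · intro i
    have h1 := hmem.2 i
    simp only [Pi.sub_apply, Pi.add_apply] at h1 ⊢
    linarith

/-- **Theorem 10.9, `Y̲ᵢ ≤ x̃ᵢ + Z̲ᵢ + Δ̄ᵢ`** (second inequality of (10.23)) for arbitrary data sets,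
given that the lower range value `Z̲ᵢ` is ATTAINED by some member: some point of `Σ(𝓐, 𝓑)` has
`i`-th coordinate `≤ x̃ᵢ + Z̲ᵢ + Δ̄ᵢ`. [cite: Rump2010Verification, Thm 10.9 (10.23)] -/
theorem thm_10_9_inner_inf (hlu : l ≤ u)
    (h : ∀ A ∈ 𝓐, ∀ b ∈ 𝓑, ∀ x ∈ Icc l u,
      R *ᵥ (b - A *ᵥ xt) + (1 - R * A) *ᵥ x ∈ interior (Icc l u))
    (hΔ : ∀ A ∈ 𝓐, ∀ x ∈ Icc l u, (1 - R * A) *ᵥ x ∈ Icc Δlo Δhi) (i : n)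
    (hatt : ∃ A ∈ 𝓐, ∃ b ∈ 𝓑, (R *ᵥ (b - A *ᵥ xt)) i = Zlo i) :
    ∃ x ∈ solutionSet 𝓐 𝓑, x i ≤ xt i + Zlo i + Δhi i := by
  obtain ⟨A, hA, b, hb, hZi⟩ := hatt
  obtain ⟨hsol, hbox⟩ := thm_10_9_member hlu h hΔ hA hb
  refine ⟨A⁻¹ *ᵥ b, hsol, ?_⟩
  have h2 := hbox.2 i
  simp only [Pi.add_apply] at h2
  rw [hZi] at h2
  exact h2

/-- **Theorem 10.9, `x̃ᵢ + Z̄ᵢ + Δ̲ᵢ ≤ Ȳᵢ`** (third inequality of (10.23)) for arbitrary data sets, given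
that the upper range value `Z̄ᵢ` is attained by some member: some point of `Σ(𝓐, 𝓑)` has `i`-th
coordinate `≥ x̃ᵢ + Z̄ᵢ + Δ̲ᵢ`. [cite: Rump2010Verification, Thm 10.9 (10.23)] -/
theorem thm_10_9_inner_sup (hlu : l ≤ u)
    (h : ∀ A ∈ 𝓐, ∀ b ∈ 𝓑, ∀ x ∈ Icc l u,
      R *ᵥ (b - A *ᵥ xt) + (1 - R * A) *ᵥ x ∈ interior (Icc l u))
    (hΔ : ∀ A ∈ 𝓐, ∀ x ∈ Icc l u, (1 - R * A) *ᵥ x ∈ Icc Δlo Δhi) (i : n)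
    (hatt : ∃ A ∈ 𝓐, ∃ b ∈ 𝓑, (R *ᵥ (b - A *ᵥ xt)) i = Zhi i) :
    ∃ x ∈ solutionSet 𝓐 𝓑, xt i + Zhi i + Δlo i ≤ x i := by
  obtain ⟨A, hA, b, hb, hZi⟩ := hatt
  obtain ⟨hsol, hbox⟩ := thm_10_9_member hlu h hΔ hA hb
  refine ⟨A⁻¹ *ᵥ b, hsol, ?_⟩
  have h1 := hbox.1 i
  simp only [Pi.add_apply] at h1
  rw [hZi] at h1
  exact h1

end General

/-! ## §3 Entrywise interval data: the extreme members are sign-selected corners -/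

section Box

/-- The interval matrix `[A̲, Ā]` as a set of members (Mathlib matrices carry no order instance).
[cite: Rump2010Verification, Thm 10.9 (data `𝐀 ∈ 𝕀ℝⁿˣⁿ`)] -/
def matBox (Alo Ahi : Matrix n n ℝ) : Set (Matrix n n ℝ) :=
  {A | ∀ j k, Alo j k ≤ A j k ∧ A j k ≤ Ahi j k}

/-- The right-hand side corner MINIMISING the `i`-th component of `R(b − Ax̃)`: `bⱼ := b̲ⱼ` if
`Rᵢⱼ ≥ 0`, else `b̄ⱼ`. [cite: Rump2010Verification, Thm 10.9 with (9.4)/(9.6)] -/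
def loCornerVec (R : Matrix n n ℝ) (blo bhi : n → ℝ) (i : n) : n → ℝ :=
  fun j => if 0 ≤ R i j then blo j else bhi j

/-- The matrix corner MINIMISING the `i`-th component of `R(b − Ax̃)`: the coefficient of `Aⱼₖ` is
`−Rᵢⱼ x̃ₖ`, so `Aⱼₖ := Āⱼₖ` if `Rᵢⱼ x̃ₖ ≥ 0`, else `A̲ⱼₖ`. [cite: Rump2010Verification, Thm 10.9 with (9.4)/(9.6)] -/
def loCornerMat (R : Matrix n n ℝ) (xt : n → ℝ) (Alo Ahi : Matrix n n ℝ) (i : n) : Matrix n n ℝ :=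
  fun j k => if 0 ≤ R i j * xt k then Ahi j k else Alo j k

/-- The right-hand side corner MAXIMISING the `i`-th component of `R(b − Ax̃)`.
[cite: Rump2010Verification, Thm 10.9 with (9.4)/(9.6)] -/
def hiCornerVec (R : Matrix n n ℝ) (blo bhi : n → ℝ) (i : n) : n → ℝ :=
  fun j => if 0 ≤ R i j then bhi j else blo j

/-- The matrix corner MAXIMISING the `i`-th component of `R(b − Ax̃)`.
[cite: Rump2010Verification, Thm 10.9 with (9.4)/(9.6)] -/
def hiCornerMat (R : Matrix n n ℝ) (xt : n → ℝ) (Alo Ahi : Matrix n n ℝ) (i : n) : Matrix n n ℝ :=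
  fun j k => if 0 ≤ R i j * xt k then Alo j k else Ahi j k

/-- `Z̲ᵢ`: the `i`-th component of `R(b − Ax̃)` at the minimising corner — the exact infimum of the
interval evaluation `R(𝐛 − 𝐀x̃)` (each interval entry occurs once per component).
[cite: Rump2010Verification, Thm 10.9 (10.21)] -/
def zInf (R : Matrix n n ℝ) (xt : n → ℝ) (Alo Ahi : Matrix n n ℝ) (blo bhi : n → ℝ) (i : n) : ℝ :=
  (R *ᵥ (loCornerVec R blo bhi i - loCornerMat R xt Alo Ahi i *ᵥ xt)) i

/-- `Z̄ᵢ`: the `i`-th component of `R(b − Ax̃)` at the maximising corner.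
[cite: Rump2010Verification, Thm 10.9 (10.21)] -/
def zSup (R : Matrix n n ℝ) (xt : n → ℝ) (Alo Ahi : Matrix n n ℝ) (blo bhi : n → ℝ) (i : n) : ℝ :=
  (R *ᵥ (hiCornerVec R blo bhi i - hiCornerMat R xt Alo Ahi i *ᵥ xt)) i

variable {R : Matrix n n ℝ} {xt : n → ℝ} {Alo Ahi : Matrix n n ℝ} {blo bhi : n → ℝ}

omit [Fintype n] in
/-- The minimising corner matrix is a member of `[A̲, Ā]`. [cite: Rump2010Verification, Thm 10.9] -/
theorem loCornerMat_mem (hA : ∀ j k, Alo j k ≤ Ahi j k) (i : n) :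
    loCornerMat R xt Alo Ahi i ∈ matBox Alo Ahi := by
  intro j k
  unfold loCornerMat
  split_ifs
  · exact ⟨hA j k, le_rfl⟩
  · exact ⟨le_rfl, hA j k⟩

omit [Fintype n] in
/-- The maximising corner matrix is a member of `[A̲, Ā]`. [cite: Rump2010Verification, Thm 10.9] -/
theorem hiCornerMat_mem (hA : ∀ j k, Alo j k ≤ Ahi j k) (i : n) :
    hiCornerMat R xt Alo Ahi i ∈ matBox Alo Ahi := by
  intro j k
  unfold hiCornerMat
  split_ifs
  · exact ⟨le_rfl, hA j k⟩
  · exact ⟨hA j k, le_rfl⟩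

omit [Fintype n] in
/-- The minimising corner vector is a member of `[b̲, b̄]`. [cite: Rump2010Verification, Thm 10.9] -/
theorem loCornerVec_mem (hb : blo ≤ bhi) (i : n) : loCornerVec R blo bhi i ∈ Icc blo bhi := by
  constructor <;> intro j <;> unfold loCornerVec <;> split_ifs
  exacts [le_rfl, hb j, hb j, le_rfl]

omit [Fintype n] in
/-- The maximising corner vector is a member of `[b̲, b̄]`. [cite: Rump2010Verification, Thm 10.9] -/
theorem hiCornerVec_mem (hb : blo ≤ bhi) (i : n) : hiCornerVec R blo bhi i ∈ Icc blo bhi := by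
  constructor <;> intro j <;> unfold hiCornerVec <;> split_ifs
  exacts [hb j, le_rfl, le_rfl, hb j]

/-- Entrywise expansion: `(R(b − Ax̃))ᵢ = Σⱼ (Rᵢⱼ bⱼ − Σₖ (Rᵢⱼ x̃ₖ) Aⱼₖ)` — linear in the data entries,
each occurring once. [folklore] -/
private theorem zApply_eq (R A : Matrix n n ℝ) (b xt : n → ℝ) (i : n) :
    (R *ᵥ (b - A *ᵥ xt)) i = ∑ j, (R i j * b j - ∑ k, R i j * xt k * A j k) := by
  simp only [Matrix.mulVec, dotProduct, Pi.sub_apply, mul_sub, Finset.mul_sum]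
  refine Finset.sum_congr rfl fun j _ => ?_
  congr 1
  exact Finset.sum_congr rfl fun k _ => by ring

/-- **`Z̲ᵢ` is a lower bound of the range:** `zInf ≤ (R(b − Ax̃))ᵢ` for every member `A ∈ [A̲, Ā]`,
`b ∈ [b̲, b̄]` (termwise sign comparison). [cite: Rump2010Verification, Thm 10.9 with (9.4)/(9.6)] -/
theorem zInf_le {A : Matrix n n ℝ} (hA : A ∈ matBox Alo Ahi) {b : n → ℝ} (hb : b ∈ Icc blo bhi)
    (i : n) : zInf R xt Alo Ahi blo bhi i ≤ (R *ᵥ (b - A *ᵥ xt)) i := by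
  unfold zInf
  rw [zApply_eq, zApply_eq]
  refine Finset.sum_le_sum fun j _ => ?_
  apply sub_le_sub
  · unfold loCornerVec
    split_ifs with hR
    · exact mul_le_mul_of_nonneg_left (hb.1 j) hR
    · exact mul_le_mul_of_nonpos_left (hb.2 j) (le_of_lt (not_le.1 hR))
  · refine Finset.sum_le_sum fun k _ => ?_
    unfold loCornerMat
    split_ifs with hc
    · exact mul_le_mul_of_nonneg_left (hA j k).2 hc
    · exact mul_le_mul_of_nonpos_left (hA j k).1 (le_of_lt (not_le.1 hc))

/-- **`Z̄ᵢ` is an upper bound of the range:** `(R(b − Ax̃))ᵢ ≤ zSup` for every member.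
[cite: Rump2010Verification, Thm 10.9 with (9.4)/(9.6)] -/
theorem le_zSup {A : Matrix n n ℝ} (hA : A ∈ matBox Alo Ahi) {b : n → ℝ} (hb : b ∈ Icc blo bhi)
    (i : n) : (R *ᵥ (b - A *ᵥ xt)) i ≤ zSup R xt Alo Ahi blo bhi i := by
  unfold zSup
  rw [zApply_eq, zApply_eq]
  refine Finset.sum_le_sum fun j _ => ?_
  apply sub_le_sub
  · unfold hiCornerVec
    split_ifs with hR
    · exact mul_le_mul_of_nonneg_left (hb.2 j) hR
    · exact mul_le_mul_of_nonpos_left (hb.1 j) (le_of_lt (not_le.1 hR))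
  · refine Finset.sum_le_sum fun k _ => ?_
    unfold hiCornerMat
    split_ifs with hc
    · exact mul_le_mul_of_nonneg_left (hA j k).1 hc
    · exact mul_le_mul_of_nonpos_left (hA j k).2 (le_of_lt (not_le.1 hc))

/-- **Rump 2010, Theorem 10.9 for entrywise interval data `𝐀 = [A̲, Ā]`, `𝐛 = [b̲, b̄]`** (both
nonempty), point `R`, `x̃`, nonempty box `X = [l, u]`, any enclosure `[Δ̲, Δ̄]` of `(I − R𝐀)X`, and the
test (10.22) in exact-range form.  Then: `R` and every `A ∈ 𝐀` are nonsingular; OUTER: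
`x̃ + Z̲ + Δ̲ ≤ x ≤ x̃ + Z̄ + Δ̄` for all `x ∈ Σ(𝐀, 𝐛)`; INNER: for every `i` some point of `Σ(𝐀, 𝐛)` has
`i`-th coordinate `≤ x̃ᵢ + Z̲ᵢ + Δ̄ᵢ` and some point has `i`-th coordinate `≥ x̃ᵢ + Z̄ᵢ + Δ̲ᵢ` — with
`Z̲ = zInf`, `Z̄ = zSup` the exact endpoints of the interval evaluation `R(𝐛 − 𝐀x̃)`.  This is (10.23)
with `Y = hull(Σ(𝐀, 𝐛))` (see §4 for the `sInf`/`sSup` wording).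
[cite: Rump2010Verification, Thm 10.9] -/
theorem thm_10_9 [DecidableEq n] (hAbox : ∀ j k, Alo j k ≤ Ahi j k) (hbbox : blo ≤ bhi)
    {l u : n → ℝ} (hlu : l ≤ u)
    (h : ∀ A ∈ matBox Alo Ahi, ∀ b ∈ Icc blo bhi, ∀ x ∈ Icc l u,
      R *ᵥ (b - A *ᵥ xt) + (1 - R * A) *ᵥ x ∈ interior (Icc l u))
    {Δlo Δhi : n → ℝ} (hΔ : ∀ A ∈ matBox Alo Ahi, ∀ x ∈ Icc l u, (1 - R * A) *ᵥ x ∈ Icc Δlo Δhi) :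
    R.det ≠ 0 ∧ (∀ A ∈ matBox Alo Ahi, A.det ≠ 0) ∧
      solutionSet (matBox Alo Ahi) (Icc blo bhi) ⊆
        Icc (xt + zInf R xt Alo Ahi blo bhi + Δlo) (xt + zSup R xt Alo Ahi blo bhi + Δhi) ∧
      (∀ i, ∃ x ∈ solutionSet (matBox Alo Ahi) (Icc blo bhi),
        x i ≤ xt i + zInf R xt Alo Ahi blo bhi i + Δhi i) ∧
      ∀ i, ∃ x ∈ solutionSet (matBox Alo Ahi) (Icc blo bhi),
        xt i + zSup R xt Alo Ahi blo bhi i + Δlo i ≤ x i := by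
  have hbne : (Icc blo bhi).Nonempty := nonempty_Icc.2 hbbox
  have hAlo : Alo ∈ matBox Alo Ahi := fun j k => ⟨le_rfl, hAbox j k⟩
  have hR : R.det ≠ 0 :=
    (thm_10_6_residual Alo R blo xt hlu (h Alo hAlo blo (left_mem_Icc.2 hbbox))).2.1
  refine ⟨hR, fun A hA => ((thm_10_8 hbne R xt hlu h).1 A hA), ?_, fun i => ?_, fun i => ?_⟩
  · exact thm_10_9_outer hlu h (fun A hA b hb => ⟨fun i => zInf_le hA hb i, fun i => le_zSup hA hb i⟩) hΔ
  · exact thm_10_9_inner_inf hlu h hΔ i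
      ⟨_, loCornerMat_mem hAbox i, _, loCornerVec_mem hbbox i, rfl⟩
  · exact thm_10_9_inner_sup hlu h hΔ i
      ⟨_, hiCornerMat_mem hAbox i, _, hiCornerVec_mem hbbox i, rfl⟩

/-! ## §4 The hull wording: `Y̲ᵢ = inf`, `Ȳᵢ = sup` of the `i`-th coordinate over `Σ(𝐀, 𝐛)` -/

/-- **(10.23) verbatim for the interval hull `Y = hull(Σ(𝐀, 𝐛))`:** with
`Y̲ᵢ := inf {xᵢ : x ∈ Σ}` and `Ȳᵢ := sup {xᵢ : x ∈ Σ}` (conditionally complete `sInf`/`sSup` over the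
nonempty, bounded coordinate images), `x̃ᵢ + Z̲ᵢ + Δ̲ᵢ ≤ Y̲ᵢ ≤ x̃ᵢ + Z̲ᵢ + Δ̄ᵢ` and
`x̃ᵢ + Z̄ᵢ + Δ̲ᵢ ≤ Ȳᵢ ≤ x̃ᵢ + Z̄ᵢ + Δ̄ᵢ`. [cite: Rump2010Verification, Thm 10.9 (10.23)] -/
theorem thm_10_9_hull [DecidableEq n] (hAbox : ∀ j k, Alo j k ≤ Ahi j k) (hbbox : blo ≤ bhi)
    {l u : n → ℝ} (hlu : l ≤ u)
    (h : ∀ A ∈ matBox Alo Ahi, ∀ b ∈ Icc blo bhi, ∀ x ∈ Icc l u,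
      R *ᵥ (b - A *ᵥ xt) + (1 - R * A) *ᵥ x ∈ interior (Icc l u))
    {Δlo Δhi : n → ℝ} (hΔ : ∀ A ∈ matBox Alo Ahi, ∀ x ∈ Icc l u, (1 - R * A) *ᵥ x ∈ Icc Δlo Δhi)
    (i : n) :
    let Y : Set ℝ := (fun x : n → ℝ => x i) '' solutionSet (matBox Alo Ahi) (Icc blo bhi)
    xt i + zInf R xt Alo Ahi blo bhi i + Δlo i ≤ sInf Y ∧
      sInf Y ≤ xt i + zInf R xt Alo Ahi blo bhi i + Δhi i ∧
      xt i + zSup R xt Alo Ahi blo bhi i + Δlo i ≤ sSup Y ∧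
      sSup Y ≤ xt i + zSup R xt Alo Ahi blo bhi i + Δhi i := by
  intro Y
  obtain ⟨-, -, hout, hinf, hsup⟩ := thm_10_9 hAbox hbbox hlu h hΔ
  have hlo : ∀ y ∈ Y, xt i + zInf R xt Alo Ahi blo bhi i + Δlo i ≤ y := by
    rintro y ⟨x, hx, rfl⟩
    have := (hout hx).1 i
    simpa only [Pi.add_apply] using this
  have hhi : ∀ y ∈ Y, y ≤ xt i + zSup R xt Alo Ahi blo bhi i + Δhi i := by
    rintro y ⟨x, hx, rfl⟩
    have := (hout hx).2 i
    simpa only [Pi.add_apply] using this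
  have hbb : BddBelow Y := ⟨_, hlo⟩
  have hba : BddAbove Y := ⟨_, hhi⟩
  obtain ⟨x₁, hx₁, hle₁⟩ := hinf i
  obtain ⟨x₂, hx₂, hle₂⟩ := hsup i
  have hne : Y.Nonempty := ⟨x₁ i, x₁, hx₁, rfl⟩
  refine ⟨le_csInf hne hlo, ?_, ?_, csSup_le hne hhi⟩
  · exact (csInf_le hbb ⟨x₁, hx₁, rfl⟩).trans hle₁
  · exact hle₂.trans (le_csSup hba ⟨x₂, hx₂, rfl⟩)

end Box

end Literature.Analysis.ValidatedNumerics.RumpLinearSystem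

end
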